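import Summits.QuantumFields.QCD.Theorems.ExtinctionBuildsQCD.Negative.VolumeLever

/-!
# Negative knowledge for crux `ExtinctionBuildsQCD` (stmt-QuantumFields-8968), §4 corrected: the
# volume lever with the BOX form of the index-spreading hypothesis

Certified copy of §4 (corrected) of the cdisprove work file
`Summits/QuantumFields/QCD/Cruxes/ExtinctionBuildsQCD/Disproof.lean` (refuter, cdisprove seat,
cycle 2). Supports stmt-QuantumFields-8968; asserts no route item. SUPERSEDES the hypothesis
`IndexSpread` of `VolumeLever.lean` (same seat, p75044):

* CORRECTION. `IndexSpread N_f` asked, at FIXED volume `L'`, for `E₊|index(-a_k M/Z_k)| ≥ 1` uniformly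
  in `M ∈ (0, K]`. That is FALSE (not merely unproved): for every gauge field off the null set
  `det D_W(U,0,1) = 0` the index at probe `-δ` vanishes once `δ` is below the least real eigenvalue of
  `D_W(U,0,1)` (`index_eq_zero_of_no_realMode`, `IndexBudget.lean`), so at fixed `(k, L')` dominated
  convergence gives `E₊|index(-a_k M/Z_k)| → 0` as `M → 0⁺`. The implications proved in
  `VolumeLever.lean` stay true but carry nothing. The intended hypothesis quantifies masses and probe
  parameter over a COMPACT box `[1/(K+1), K+1]`: `IndexSpreadBox` below; heuristically TRUE (positive
  rate per site of tip real modes from instantons in cold patches; reflection-symmetric index law;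
  decorrelation of distant patches — module docstring of `VolumeLever.lean`), its central-limit part not
  provable now; TIGHT needs each `(m, M)` only eventually in `k`, so the diagonal volume choice still
  works (`tight_tipReg_of_indexSpreadBox`).
* RESULTS (as in `VolumeLever.lean`, with the box hypothesis): `sdWith_of_indexSpreadBox`,
  `sdHyp_of_indexSpreadBox : IndexSpreadBox N_f → SD(N_f)` (tip family: `canonicalAF`, line at bare
  mass `0`, EXTINCT free, witness-chosen huge volumes), `extinctionBuildsQCD_iff_qcd_of_indexSpreadBox :
  IndexSpreadBox 2 → IndexSpreadBox 3 → (ExtinctionBuildsQCD ↔ QCD)`, `collapse_schema_of_indexSpreadBox`,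
  `collapse_with_branchClause_of_indexSpreadBox`. Repairs for the planner (volume cap
  `∃ p, ∀ᶠ k, L_k ≤ a_k^{-p}` / extensive TIGHT / fixed physical torus): `VolumeLever.lean` docstring.

References: Edwards–Heller–Narayanan, Nucl. Phys. B 535 (1998) 403 (index = net chirality of real
modes); Berruto–Narayanan–Neuberger, Phys. Lett. B 489 (2000) 243, §7 (entropy of defect-bound real
modes); Lüscher, Comm. Math. Phys. 85 (1982) 39 (dislocations: entropy versus action).
-/

noncomputable section

namespace Summit.QuantumFields.QCD.Theorems.ExtinctionBuildsQCD.Negative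

open scoped BigOperators Topology Classical MeasureTheory Matrix ComplexConjugate
open Filter MeasureTheory Matrix
open Literature.MathematicalPhysics.QuantumLattice Literature.MathematicalPhysics.QuantumFieldTheory
  Literature.Probability.LatticeModels
open Summit.QuantumFields.QCD.Theses.SpectralDefectExtinction

section VolumeLeverBox

variable {Nf : ℕ}

variable (Nf) in
/-- **Infinite-volume index spreading at fixed cutoff** (the statement `SD(N_f)` reduces to on the tip
family). For every bound `K` on the masses there is `k₀` such that at every LATER step `k` — i.e. at the
FIXED bare parameters `β_k = afBeta N_f 1 (k+1)⁻¹`, `a_k = (k+1)⁻¹`, `Z_k = (log (k+1)²)^{γ₀/(2β₀)}`,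
line `m_crit = 0` — the phase-quenched (weights `∏_f |det D_W(U, a_k m_f/Z_k, 1)|`) expectation of
`|n₋(Γ₅ D_W(U, -a_k M/Z_k, 1)) - 6(2L'+1)⁴|` on the torus `(2L'+1)⁴` is `≥ 1` for ALL sufficiently large
`L'`, uniformly for masses and probe parameter in the COMPACT box `[1/(K+1), K+1]`. A thermodynamic-limit
statement about lattice `SU(3)` gauge fields with a positive quasi-local tilt at ONE coupling: no
continuum limit, no OS data, no mass gap. Heuristically TRUE (module docstring of §4: tip real modes have
a positive rate per site, the index law is reflection-symmetric, distant cold patches decorrelate); its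
central-limit part is not provable now.

CORRECTION (cycle 2, same seat). The first landed form of this hypothesis, `Negative.IndexSpread`
(`Theorems/…/Negative/VolumeLever.lean`, p75044), asked for uniformity in `M ∈ (0, K]` at FIXED volume
`L'`; that form is FALSE, not merely unproved: for every gauge field off the null set
`det D_W(U,0,1) = 0` the index at probe `-δ` vanishes once `δ` is below the least real eigenvalue
(`index_eq_zero_of_no_realMode`, §5), so by dominated convergence `E₊|index(-a_k M/Z_k)| → 0` as
`M → 0⁺` at fixed `(k, L')`. The theorems of `VolumeLever.lean` remain true (implications) but say
nothing; the box form below is the intended hypothesis and `VolumeLeverBox.lean` supersedes. -/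
def IndexSpreadBox : Prop :=
  ∀ K : ℕ, ∃ k₀ : ℕ, ∀ k : ℕ, k₀ ≤ k → ∃ L₀ : ℕ, ∀ L' : ℕ, L₀ ≤ L' →
    ∀ m : Fin Nf → ℝ, (∀ f, ((K : ℝ) + 1)⁻¹ ≤ m f ∧ m f ≤ K + 1) →
      ∀ M : ℝ, ((K : ℝ) + 1)⁻¹ ≤ M → M ≤ K + 1 →
        1 ≤ tightRatio (QCDRegularisation.canonicalAF Nf) k L' m M

/-- **The tip family is TIGHT modulo `IndexSpreadBox`**: a diagonal choice of volumes
`L_k := max (L_k^{can}, max_{K ≤ k} L₀(K, k))` makes `tipReg L` satisfy TIGHT with threshold `M₀ = 0` for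
every positive mass tuple. -/
theorem tight_tipReg_of_indexSpreadBox (h : IndexSpreadBox Nf) :
    ∃ (L' : ℕ → ℕ) (hL' : Tendsto (fun k => (QCDRegularisation.canonicalAF Nf).a k * L' k) atTop atTop),
      ∀ m : Fin Nf → ℝ, (∀ f, 0 < m f) → Tight Nf (tipReg Nf L' hL') 0 m := by
  classical
  choose k₀ hk₀ using h
  -- `L₀ K k` for `k ≥ k₀ K` (junk `0` otherwise)
  have hL₀ : ∀ K k : ℕ, ∃ L₀ : ℕ, k₀ K ≤ k → ∀ L' : ℕ, L₀ ≤ L' →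
      ∀ m : Fin Nf → ℝ, (∀ f, ((K : ℝ) + 1)⁻¹ ≤ m f ∧ m f ≤ K + 1) →
        ∀ M : ℝ, ((K : ℝ) + 1)⁻¹ ≤ M → M ≤ K + 1 →
          1 ≤ tightRatio (QCDRegularisation.canonicalAF Nf) k L' m M := by
    intro K k
    by_cases hk : k₀ K ≤ k
    · obtain ⟨L₀, hL⟩ := hk₀ K k hk
      exact ⟨L₀, fun _ => hL⟩
    · exact ⟨0, fun h => absurd h hk⟩
  choose L₀ hL₀' using hL₀
  set can := QCDRegularisation.canonicalAF Nf with hcan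
  -- the diagonal volumes
  let L : ℕ → ℕ := fun k => max (can.L k) ((Finset.range (k + 1)).sup fun K => L₀ K k)
  have hLge : ∀ k, can.L k ≤ L k := fun k => le_max_left _ _
  have hLge' : ∀ K k, K ≤ k → L₀ K k ≤ L k := fun K k hKk =>
    (Finset.le_sup (f := fun K => L₀ K k) (Finset.mem_range.2 (Nat.lt_succ_of_le hKk))).trans
      (le_max_right _ _)
  have hL : Tendsto (fun k => can.a k * L k) atTop atTop := by
    refine tendsto_atTop_mono (fun k => ?_) can.tendsto_L
    exact mul_le_mul_of_nonneg_left (by exact_mod_cast hLge k) (can.a_pos k).le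
  refine ⟨L, hL, fun m hm M hM => ?_⟩
  -- a common box `[1/(K+1), K+1]` containing the masses and the probe parameter
  obtain ⟨K, hK⟩ : ∃ K : ℕ, (∀ f, ((K : ℝ) + 1)⁻¹ ≤ m f ∧ m f ≤ K + 1) ∧
      ((K : ℝ) + 1)⁻¹ ≤ M ∧ M ≤ K + 1 := by
    set B : ℝ := max (max M M⁻¹) (∑ f, (m f + (m f)⁻¹)) with hB
    refine ⟨⌈B⌉₊, fun f => ⟨?_, ?_⟩, ?_, ?_⟩
    · refine inv_le_of_inv_le₀ (hm f) ?_
      calc (m f)⁻¹ ≤ m f + (m f)⁻¹ := le_add_of_nonneg_left (hm f).le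
        _ ≤ ∑ g, (m g + (m g)⁻¹) := Finset.single_le_sum
            (fun g _ => add_nonneg (hm g).le (inv_nonneg.2 (hm g).le)) (Finset.mem_univ f)
        _ ≤ B := le_max_right _ _
        _ ≤ ⌈B⌉₊ + 1 := (Nat.le_ceil _).trans (le_add_of_nonneg_right zero_le_one)
    · calc m f ≤ m f + (m f)⁻¹ := le_add_of_nonneg_right (inv_nonneg.2 (hm f).le)
        _ ≤ ∑ g, (m g + (m g)⁻¹) := Finset.single_le_sum
            (fun g _ => add_nonneg (hm g).le (inv_nonneg.2 (hm g).le)) (Finset.mem_univ f)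
        _ ≤ B := le_max_right _ _
        _ ≤ ⌈B⌉₊ + 1 := (Nat.le_ceil _).trans (le_add_of_nonneg_right zero_le_one)
    · refine inv_le_of_inv_le₀ hM ?_
      calc M⁻¹ ≤ max M M⁻¹ := le_max_right _ _
        _ ≤ B := le_max_left _ _
        _ ≤ ⌈B⌉₊ + 1 := (Nat.le_ceil _).trans (le_add_of_nonneg_right zero_le_one)
    · calc M ≤ max M M⁻¹ := le_max_left _ _
        _ ≤ B := le_max_left _ _
        _ ≤ ⌈B⌉₊ + 1 := (Nat.le_ceil _).trans (le_add_of_nonneg_right zero_le_one)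
  filter_upwards [Filter.eventually_ge_atTop (max (k₀ K) K)] with k hk
  have hk₀K : k₀ K ≤ k := le_of_max_le_left hk
  have hKk : K ≤ k := le_of_max_le_right hk
  -- the scheme's own torus at step `k` is `L k`, and the ratio does not see the volume datum
  exact hL₀' K k hk₀K (L k) (hLge' K k hKk) m hK.1 M hK.2.1 hK.2.2

/-- **`SD(N_f)` with ANY extra side condition met by the tip family holds modulo `IndexSpreadBox`.** The tip
regularisation is mass-scaling, asymptotically scaling, EXTINCT for all positive masses with `c = 1`
(free, §2) and TIGHT with `M₀ = 0` — the "spectrally clean, tight" witness `WindowExtinction` asks for,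
with its line at bare mass ZERO (quarks infinitely heavy in physical units: it sits `|m_crit^{phys}(g₀)| ≍ g₀²`
lattice units, i.e. `≍ g₀²/a_k → ∞` physical units, above the physical critical line). -/
theorem sdWith_of_indexSpreadBox (P : QCDRegularisation Nf → Prop) (hP : ∀ L' hL', P (tipReg Nf L' hL'))
    (h : IndexSpreadBox Nf) :
    ∃ reg : QCDRegularisation Nf, P reg ∧ reg.HasMassScaling ∧ (reg.scheme 0 0 0).HasAsymptoticScaling ∧
      ∃ M₀ : ℝ, 0 ≤ M₀ ∧ ∃ c : ℝ, 0 < c ∧ ∀ m : Fin Nf → ℝ, (∀ f, M₀ < m f) →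
        Extinct Nf reg c m ∧ Tight Nf reg M₀ m := by
  obtain ⟨L', hL', hT⟩ := tight_tipReg_of_indexSpreadBox h
  exact ⟨tipReg Nf L' hL', hP L' hL', QCDRegularisation.canonicalAF_hasMassScaling,
    QCDScheme.zeroAF_hasAsymptoticScaling, 0, le_rfl, 1, one_pos, fun m hm =>
      ⟨extinct_withVolume_of_mcrit_nonneg _ L' hL' (fun _ => le_rfl) le_rfl m hm, hT m hm⟩⟩

/-- **`SD(N_f)` holds modulo `IndexSpreadBox`** (tip witness). -/
theorem sdHyp_of_indexSpreadBox (h : IndexSpreadBox Nf) : SDHyp Nf := by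
  obtain ⟨reg, -, h⟩ := sdWith_of_indexSpreadBox (fun _ => True) (fun _ _ => trivial) h
  exact ⟨reg, h⟩

-- buildfix 2026-08-19 (maintenance): `extinctionBuildsQCD_iff_qcd_of_indexSpreadBox` and
-- `not_extinctionBuildsQCD_iff_not_qcd_of_indexSpreadBox` REMOVED — voided by route rev 9 (SD⁺ restate,
-- 2026-08-17; route docstring: 'summit-equivalence flag of rev ≤ 8 … VOIDED'): `sdHyp_of_indexSpreadBox` yields
-- `SDHyp`, not SD⁺, and the restated conclusion is THR, not `QCDOf`. Everything else is untouched.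

/-- **Collapse schema with side conditions.** For ANY candidate side condition `P` on the regularisation
that the tip family satisfies at every admissible volume (e.g. `∀ᶠ k, -1 < m_crit k` — the physical-branch
clause suggested in FINDINGS-ideator1 F4 —, `m_crit(k) → 0`, `|m_crit(k)| ≤ C g₀(k)²`, `m_crit ∈ [-8,0]`):
adding `P` to `SD` does not undo the collapse modulo `IndexSpreadBox`. Only a condition that sees the VOLUME
(R1–R3 of the module docstring) can. -/
theorem collapse_schema_of_indexSpreadBox (P : ∀ Nf : ℕ, QCDRegularisation Nf → Prop)
    (hP : ∀ Nf L' hL', P Nf (tipReg Nf L' hL')) (h2 : IndexSpreadBox 2) (h3 : IndexSpreadBox 3) :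
    (∀ Nf : ℕ, (Nf = 2 ∨ Nf = 3) →
      (∃ reg : QCDRegularisation Nf, P Nf reg ∧ reg.HasMassScaling ∧
        (reg.scheme 0 0 0).HasAsymptoticScaling ∧ ∃ M₀ : ℝ, 0 ≤ M₀ ∧ ∃ c : ℝ, 0 < c ∧
          ∀ m : Fin Nf → ℝ, (∀ f, M₀ < m f) → Extinct Nf reg c m ∧ Tight Nf reg M₀ m) → QCDOf Nf) ↔
      _root_.QCD :=
  ⟨fun h => ⟨h 2 (Or.inl rfl) (sdWith_of_indexSpreadBox (P 2) (hP 2) h2),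
      h 3 (Or.inr rfl) (sdWith_of_indexSpreadBox (P 3) (hP 3) h3)⟩,
    fun hq Nf hNf _ => by
      rcases hNf with rfl | rfl
      exacts [hq.1, hq.2]⟩

/-- Instance: the physical-branch clause `∀ k, -1 < m_crit k` (FINDINGS-ideator1 F4's recommended
addition) is met by the tip family (`m_crit ≡ 0`), so it does not restore the cut. -/
theorem collapse_with_branchClause_of_indexSpreadBox (h2 : IndexSpreadBox 2) (h3 : IndexSpreadBox 3) :
    (∀ Nf : ℕ, (Nf = 2 ∨ Nf = 3) →
      (∃ reg : QCDRegularisation Nf, (∀ k, -1 < reg.mcrit k ∧ reg.mcrit k ≤ 0) ∧ reg.HasMassScaling ∧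
        (reg.scheme 0 0 0).HasAsymptoticScaling ∧ ∃ M₀ : ℝ, 0 ≤ M₀ ∧ ∃ c : ℝ, 0 < c ∧
          ∀ m : Fin Nf → ℝ, (∀ f, M₀ < m f) → Extinct Nf reg c m ∧ Tight Nf reg M₀ m) → QCDOf Nf) ↔
      _root_.QCD :=
  collapse_schema_of_indexSpreadBox (fun _ reg => ∀ k, -1 < reg.mcrit k ∧ reg.mcrit k ≤ 0)
    (fun _ _ _ _ => ⟨by norm_num [tipReg, withVolume, QCDRegularisation.canonicalAF],
      le_rfl⟩) h2 h3


end VolumeLeverBox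

end Summit.QuantumFields.QCD.Theorems.ExtinctionBuildsQCD.Negative

end
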